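import Literature.Topology.FourManifolds.KirbyMoves
import HarnessLib

/-!
# Proofs for `KirbyMoves.lean`: surgery on a reindexed framed link; the standard disc

Sibling proof file of `KirbyMoves.lean` (D-0014: named facts `def X : Prop` are discharged as
`theorem X_holds : X`). It discharges

* `Literature.FramedLink.isSurgery_reindex_iff_holds : FramedLink.isSurgery_reindex_iff` — for an
  equivalence of index types `e : κ ≃ ι` and a framed link `L` indexed by `ι`, the manifold `Y`
  is surgery on the renumbered framed link `L.reindex e` iff it is surgery on `L`;
* `Literature.isSmoothDisc_unknotDisc_holds : isSmoothDisc_unknotDisc` — the standard disc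
  `unknotDisc : ℝ² → 𝕊³`, `x ↦ (2x₀, 2x₁, 1 - ‖x‖², 0) / (1 + ‖x‖²)`, bounded by the unknot is a
  smoothly embedded disc (`IsSmoothDisc`: `C^∞`, injective on the closed unit disc, injective
  differential at every point of it).

## Surgery on a reindexed framed link

Source: folklore bookkeeping. Rolfsen, *Knots and Links* (1976), §9.F and Gompf–Stipsicz,
*4-Manifolds and Kirby Calculus* (1999), §5.3 define surgery on a framed link componentwise, the
result visibly not depending on how the components are numbered. With the relational definition
`Literature.Topology.FourManifolds.IsIntegralSurgeryLink` of `DehnSurgery.lean` no printed argument is needed: renumbering along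
`e` changes neither the link complement `S³ ∖ L` (`FramedLink.complement_reindex`: the union of
the components is the same set) nor the family of glued solid tori, so a surgery presentation
`(ν, jA, jB)` of `Y` on `L` yields the presentation `(ν ∘ e, jA, jB ∘ e)` on `L.reindex e`
(`FramedLink.IsSurgery.reindex`), the embedding `jA` of the complement being transported along
the equality of open sets. The converse is the same statement for `e.symm` and `L.reindex e`,
because `(L.reindex e).reindex e.symm = L` (`FramedLink.reindex_reindex_symm`).

## The standard disc bounded by the unknot

Source: folklore (elementary calculus). `unknotDisc` is the inverse `σ̃⁻¹` of the stereographic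
projection `σ̃ (y) = (y₀, y₁) / (1 + y₂)` of the great `2`-sphere `{x₃ = 0} ⊆ 𝕊³` from its south
pole `(0, 0, -1, 0)`; Lee, *Introduction to Smooth Manifolds*, 2nd ed. (2013), Problem 1-7(b)
prints the pair `σ̃ (x) = -σ (-x)`, `σ̃⁻¹ (u) = (2u, 1 - |u|²) / (1 + |u|²)` (there for
`𝕊ⁿ ⊆ ℝⁿ⁺¹`; here `n = 2`, followed by the equatorial inclusion `𝕊² ⊆ 𝕊³`). The proof avoids
any explicit derivative:

* smoothness (`contMDiff_unknotDisc`): the `ℝ⁴`-valued map `x ↦ (unknotDisc x : ℝ⁴)` is `C^∞`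
  (`contDiff_coe_unknotDisc`: coordinatewise rational, denominator `1 + ‖x‖² > 0`), and
  `unknotDisc` is its corestriction to the sphere (Mathlib `ContMDiff.codRestrict_sphere`);
* left inverse (`exists_leftInverse_unknotDisc`): the projection `σ̃ : 𝕊³ → ℝ²`,
  `y ↦ (y₀, y₁) / (1 + y₂)` (one formula on all of `𝕊³`, junk value `x / 0 = 0` on `{y₂ = -1}`,
  which misses the disc as `1 + (unknotDisc x)₂ = 2 / (1 + ‖x‖²)`, `one_add_coe_unknotDisc_two`)
  satisfies `σ̃ ∘ unknotDisc = id` on `ℝ²` and is `C^∞` at every point of the disc (quotients,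
  composed with the inclusion `𝕊³ ⊆ ℝ⁴`, Mathlib `contMDiff_coe_sphere`); whence injectivity on
  `ℝ²` (`injective_unknotDisc`);
* immersion (`mfderiv_unknotDisc_injective`): by the chain rule
  `mfderiv σ̃ (unknotDisc x) ∘ mfderiv unknotDisc x = mfderiv id x = id`, so the differential of
  `unknotDisc` is injective at every point of `ℝ²` (the left-inverse argument of
  `Literature.Topology.FourManifolds.mfderiv_circlePt_injective`, `KnotFraming.lean`).

## References

* D. Rolfsen, *Knots and Links* (1976), §9.F; R. E. Gompf, A. I. Stipsicz, *4-Manifolds and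
  Kirby Calculus* (1999), §5.3.
* J. M. Lee, *Introduction to Smooth Manifolds*, 2nd ed., GTM 218 (2013), Problem 1-7
  (stereographic projections from the poles and their inverses).
  [cite: LeeSmoothManifolds2013, Problem 1-7]
-/

open scoped Manifold ContDiff Topology
open Function Set

noncomputable section

universe u v w u'

namespace Literature.Topology.FourManifolds

namespace FramedLink

variable {ι κ : Type*}

/-- Two framed links with the same components and the same framings are equal. [folklore] -/
theorem ext' {L L' : FramedLink ι} (h : L.component = L'.component)
    (h' : L.framing = L'.framing) : L = L' := by
  rcases L with ⟨⟨c, d⟩, f⟩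
  rcases L' with ⟨⟨c', d'⟩, f'⟩
  change c = c' at h
  change f = f' at h'
  subst h h'
  rfl

/-- Reindexing along `e` and then along `e.symm` gives back the framed link. [folklore] -/
@[simp]
theorem reindex_reindex_symm (e : κ ≃ ι) (L : FramedLink ι) :
    (L.reindex e).reindex e.symm = L :=
  ext' (funext fun i ↦ by simp) (funext fun i ↦ by simp)

/-- Reindexing along `e.symm` and then along `e` gives back the framed link. [folklore] -/
@[simp]
theorem reindex_symm_reindex (e : κ ≃ ι) (L : FramedLink κ) :
    (L.reindex e.symm).reindex e = L :=
  ext' (funext fun i ↦ by simp) (funext fun i ↦ by simp)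

/-- Renumbering the components does not change the link complement `S³ ∖ L`. [folklore] -/
theorem complement_reindex [Finite ι] [Finite κ] (e : κ ≃ ι) (L : FramedLink ι) :
    (L.reindex e).toLink.complement = L.toLink.complement :=
  SetLike.ext fun x ↦ by
    simp only [Link.mem_complement_iff, reindex_component]
    exact e.forall_congr_right (q := fun i ↦ x ∉ range ⇑(L.component i))

/-- Surgery on a framed link `L` is surgery on the renumbered framed link `L.reindex e`: reindex
the tubular neighbourhoods `ν` and the solid-torus embeddings `jB` along `e`, and keep the
embedding `jA` of the (unchanged, `complement_reindex`) link complement. Folklore; cf. Rolfsen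
(1976), §9.F; Gompf–Stipsicz (1999), §5.3. [folklore] -/
theorem IsSurgery.reindex {EY HY : Type*} [NormedAddCommGroup EY] [NormedSpace ℝ EY]
    [TopologicalSpace HY] {IY : ModelWithCorners ℝ EY HY} {Y : Type*} [TopologicalSpace Y]
    [ChartedSpace HY Y] [Finite ι] [Finite κ] {L : FramedLink ι} (h : L.IsSurgery IY Y)
    (e : κ ≃ ι) : (L.reindex e).IsSurgery IY Y := by
  obtain ⟨ν, hν, hdisj, jA, jB, hA, hAo, hB, hcov, hBdisj, hglue⟩ := h
  refine ⟨fun k ↦ ν (e k), fun k ↦ hν (e k), fun k k' hkk' ↦ hdisj (e.injective.ne hkk'), ?_⟩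
  -- `Link.surgeryRel ν i a b` only sees `a` through `(a : 𝕊 3)`: unfold it, then transport the
  -- type `(L.reindex e).complement` of `jA`, `a` along `complement_reindex`.
  simp only [Link.surgeryRel]
  rw [complement_reindex e L]
  refine ⟨jA, fun k ↦ jB (e k), hA, hAo, fun k ↦ hB (e k), ?_,
    fun k k' hkk' ↦ hBdisj (e.injective.ne hkk'), fun k a b ↦ hglue (e k) a b⟩
  -- The solid tori still cover: `⋃ k, range (jB (e k)) = ⋃ i, range (jB i)` as `e` is onto.
  convert hcov using 2
  exact e.surjective.iUnion_comp fun i ↦ range (jB i)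

/-- Discharge of the named fact `FramedLink.isSurgery_reindex_iff`: `Y` is surgery on
`L.reindex e` iff it is surgery on `L` (`IsSurgery.reindex` for `e`, resp. for `e.symm` applied to
`L.reindex e`, using `(L.reindex e).reindex e.symm = L`). Folklore; cf. Rolfsen (1976), §9.F;
Gompf–Stipsicz (1999), §5.3. [folklore] -/
theorem isSurgery_reindex_iff_holds : isSurgery_reindex_iff.{u, v, w, u'} := by
  intro EY HY _ _ _ IY Y _ _ ι κ _ _ e L
  refine ⟨fun h ↦ ?_, fun h ↦ h.reindex e⟩
  have h' := h.reindex e.symm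
  rwa [reindex_reindex_symm] at h'

end FramedLink

/-! ## The standard disc bounded by the unknot is a smoothly embedded disc -/

section UnknotDisc

/-- Local notation: `𝔼 n` is the model Euclidean space `EuclideanSpace ℝ (Fin n)`. -/
local notation "𝔼 " n:arg => EuclideanSpace ℝ (Fin n)

/-- Local notation: `𝕊 n` is the unit sphere in `EuclideanSpace ℝ (Fin (n + 1))`. -/
local notation "𝕊 " n:arg => (Metric.sphere (0 : EuclideanSpace ℝ (Fin (n + 1))) 1)

/-- The standard disc as a point of `ℝ⁴` (by definition):
`unknotDisc x = (2x₀, 2x₁, 1 - ‖x‖², 0) / (1 + ‖x‖²)`. [folklore] -/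
theorem coe_unknotDisc (x : 𝔼 2) :
    (unknotDisc x : 𝔼 4) = WithLp.toLp 2 ((1 + ‖x‖ ^ 2)⁻¹ • ![2 * x 0, 2 * x 1, 1 - ‖x‖ ^ 2, 0]) :=
  rfl

/-- The `ℝ⁴`-valued standard disc `x ↦ (unknotDisc x : ℝ⁴)` is `C^∞`: its coordinates are the
rational functions `2x₀ / (1 + ‖x‖²)`, `2x₁ / (1 + ‖x‖²)`, `(1 - ‖x‖²) / (1 + ‖x‖²)`, `0` with
non-vanishing denominator. [folklore] -/
theorem contDiff_coe_unknotDisc : ContDiff ℝ ∞ fun x ↦ (unknotDisc x : 𝔼 4) := by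
  have hden : ContDiff ℝ ∞ fun x : 𝔼 2 ↦ (1 + ‖x‖ ^ 2)⁻¹ :=
    (contDiff_const.add (contDiff_norm_sq ℝ)).fun_inv fun x ↦ by positivity
  simp only [coe_unknotDisc]
  refine PiLp.contDiff_toLp.comp (hden.smul ?_)
  refine contDiff_pi.2 fun i ↦ ?_
  fin_cases i
  · simpa using
      (contDiff_const (c := (2 : ℝ))).mul (contDiff_piLp_apply (p := 2) (i := (0 : Fin 2)))
  · simpa using
      (contDiff_const (c := (2 : ℝ))).mul (contDiff_piLp_apply (p := 2) (i := (1 : Fin 2)))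
  · simpa using contDiff_const.sub (contDiff_norm_sq ℝ (E := 𝔼 2))
  · simpa using contDiff_const (c := (0 : ℝ))

/-- **The standard disc is `C^∞`** as a map `ℝ² → 𝕊³` (corestriction to the sphere of the smooth
`ℝ⁴`-valued map, Mathlib `ContMDiff.codRestrict_sphere`). [folklore] -/
theorem contMDiff_unknotDisc : ContMDiff 𝓘(ℝ, 𝔼 2) (𝓡 3) ∞ unknotDisc :=
  haveI := Fact.mk (@finrank_euclideanSpace_fin ℝ _ (3 + 1))
  contDiff_coe_unknotDisc.contMDiff.codRestrict_sphere fun x ↦ (unknotDisc x).2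

/-- The denominator of the stereographic projection from `(0, 0, -1, 0)` along the standard disc:
`1 + (unknotDisc x)₂ = 2 / (1 + ‖x‖²)` (in particular it does not vanish). [folklore] -/
theorem one_add_coe_unknotDisc_two (x : 𝔼 2) :
    1 + (unknotDisc x : 𝔼 4) 2 = 2 / (1 + ‖x‖ ^ 2) := by
  have h : (0 : ℝ) < 1 + ‖x‖ ^ 2 := by positivity
  simp only [coe_unknotDisc, PiLp.toLp_apply, Pi.smul_apply, smul_eq_mul]
  simp
  field_simp
  ring

/-- **The standard disc has a left inverse `𝕊³ → ℝ²` which is `C^∞` at every point of the disc**: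
the stereographic projection `σ̃ (y) = (y₀, y₁) / (1 + y₂)` of the great `2`-sphere `{x₃ = 0}`
from its south pole `(0, 0, -1, 0)`, extended to `𝕊³` by the same formula (junk value `x / 0 = 0`
on `{y₂ = -1}`, which misses the disc since `1 + (unknotDisc x)₂ = 2 / (1 + ‖x‖²)`); it is smooth
off `{y₂ = -1}` as the composition of coordinatewise quotients with the inclusion `𝕊³ ⊆ ℝ⁴`
(Mathlib `contMDiff_coe_sphere`), and `σ̃ (unknotDisc x) = x` is the identity `σ̃ ∘ σ̃⁻¹ = id` of
Lee (2013), Problem 1-7(b). [cite: LeeSmoothManifolds2013, Problem 1-7] -/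
theorem exists_leftInverse_unknotDisc :
    ∃ g : 𝕊 3 → 𝔼 2, LeftInverse g unknotDisc ∧
      ∀ x, ContMDiffAt (𝓡 3) 𝓘(ℝ, 𝔼 2) ∞ g (unknotDisc x) := by
  haveI := Fact.mk (@finrank_euclideanSpace_fin ℝ _ (3 + 1))
  -- the projection as a formula on `ℝ⁴`
  set G : 𝔼 4 → 𝔼 2 := fun y ↦ WithLp.toLp 2 ![y 0 / (1 + y 2), y 1 / (1 + y 2)] with hG
  have hGd : ∀ y : 𝔼 4, 1 + y 2 ≠ 0 → ContDiffAt ℝ ∞ G y := fun y hy ↦ by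
    refine PiLp.contDiff_toLp.contDiffAt.comp y (contDiffAt_pi.2 fun i ↦ ?_)
    have hd : ContDiffAt ℝ ∞ (fun y : 𝔼 4 ↦ 1 + y 2) y :=
      contDiffAt_const.add (contDiff_piLp_apply (p := 2) (i := (2 : Fin 4))).contDiffAt
    fin_cases i
    · simpa using (contDiff_piLp_apply (p := 2) (i := (0 : Fin 4))).contDiffAt.fun_div hd hy
    · simpa using (contDiff_piLp_apply (p := 2) (i := (1 : Fin 4))).contDiffAt.fun_div hd hy
  refine ⟨fun y ↦ G y, fun x ↦ ?_, fun x ↦ ?_⟩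
  · -- left inverse: `G (unknotDisc x) = x`
    have h : (0 : ℝ) < 1 + ‖x‖ ^ 2 := by positivity
    have h2 := one_add_coe_unknotDisc_two x
    ext i
    fin_cases i
    · simp only [hG, h2, PiLp.toLp_apply]
      simp [coe_unknotDisc]
      field_simp
    · simp only [hG, h2, PiLp.toLp_apply]
      simp [coe_unknotDisc]
      field_simp
  · -- smooth at `unknotDisc x`
    have hy : 1 + (unknotDisc x : 𝔼 4) 2 ≠ 0 := by
      rw [one_add_coe_unknotDisc_two]
      positivity
    exact (hGd _ hy).contMDiffAt.comp _ contMDiff_coe_sphere.contMDiffAt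

/-- **The standard disc is injective** on all of `ℝ²` (it has a left inverse). [folklore] -/
theorem injective_unknotDisc : Injective unknotDisc := by
  obtain ⟨g, hg, -⟩ := exists_leftInverse_unknotDisc
  exact hg.injective

/-- **The standard disc is an immersion**: its differential `mfderiv 𝓘(ℝ, ℝ²) (𝓡 3) unknotDisc x`
is injective at every `x ∈ ℝ²`. Chain rule with the left inverse `g` of
`exists_leftInverse_unknotDisc`: `g ∘ unknotDisc = id` with both maps differentiable at the
relevant points, so `mfderiv g (unknotDisc x) ∘ mfderiv unknotDisc x = mfderiv id x = id` (the
argument of `Literature.Topology.FourManifolds.mfderiv_circlePt_injective`, `KnotFraming.lean`). [folklore] -/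
theorem mfderiv_unknotDisc_injective (x : 𝔼 2) :
    Injective (mfderiv 𝓘(ℝ, 𝔼 2) (𝓡 3) unknotDisc x) := by
  obtain ⟨g, hg, hgs⟩ := exists_leftInverse_unknotDisc
  have hc : MDifferentiableAt 𝓘(ℝ, 𝔼 2) (𝓡 3) unknotDisc x :=
    contMDiff_unknotDisc.contMDiffAt.mdifferentiableAt (by simp)
  have ha : MDifferentiableAt (𝓡 3) 𝓘(ℝ, 𝔼 2) g (unknotDisc x) :=
    (hgs x).mdifferentiableAt (by simp)
  have h1 : mfderiv 𝓘(ℝ, 𝔼 2) 𝓘(ℝ, 𝔼 2) (g ∘ unknotDisc) x =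
      (mfderiv (𝓡 3) 𝓘(ℝ, 𝔼 2) g (unknotDisc x)).comp (mfderiv 𝓘(ℝ, 𝔼 2) (𝓡 3) unknotDisc x) :=
    mfderiv_comp x ha hc
  rw [hg.comp_eq_id, mfderiv_id] at h1
  intro v w hvw
  have := congrArg (mfderiv (𝓡 3) 𝓘(ℝ, 𝔼 2) g (unknotDisc x)) hvw
  rw [← ContinuousLinearMap.comp_apply, ← ContinuousLinearMap.comp_apply, ← h1] at this
  exact this

/-- Discharge of the named fact `isSmoothDisc_unknotDisc` (`KirbyMoves.lean`): **the standard disc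
bounded by the unknot is a smoothly embedded disc** — `C^∞` (`contMDiff_unknotDisc`), injective on
the closed unit disc (indeed on `ℝ²`, `injective_unknotDisc`) and with injective differential at
every point of it (indeed of `ℝ²`, `mfderiv_unknotDisc_injective`). Folklore (elementary calculus;
the inverse pair of stereographic maps is Lee (2013), Problem 1-7(b)). [folklore] -/
theorem isSmoothDisc_unknotDisc_holds : isSmoothDisc_unknotDisc :=
  ⟨contMDiff_unknotDisc, injective_unknotDisc.injOn, fun x _ ↦ mfderiv_unknotDisc_injective x⟩

end UnknotDisc

end Literature.Topology.FourManifolds
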